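import Literature.MathematicalPhysics.QuantumLattice.FermionEmbedding
import Literature.MathematicalPhysics.QuantumLattice.FermionOperatorsProofs
import HarnessLib

/-!
# Two fermionic clusters: configurations of `ι ⊕ₗ ι`, product states on `Fock (ι ⊕ₗ ι)`, and the
# action of the cluster operators and of their second quantisations

For a finite linearly ordered orbital set `ι`, the two-cluster orbital set is the linear sum
`ι ⊕ₗ ι` (every orbital of cluster 1 BELOW every orbital of cluster 2), with the order embeddings
`inlO, inrO : ι ↪o ι ⊕ₗ ι`. This file is the fermionic bookkeeping behind the one-cluster formula
`interClusterKernel` of `ClusterPairBosonCouplings` (whose identification with Kato's second-order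
kernel of the two-cluster system is deferred there and proved in
`InterClusterKernelIdentification`). Three parts:

**I. Configurations.** A configuration `s ⊆ ι ⊕ₗ ι` splits into its cluster parts `pre inlO s`,
`pre inrO s ⊆ ι` (`JWEmbed.pre` of `FermionEmbedding`), bijectively (`glue`, `glue_pre`,
`splitEquiv`, `sum_split`); inserting / erasing one orbital acts on one part. The two
Jordan–Wigner signs (`jwSign i s = (-1)^{#{j ∈ s, j < i}}` of `HubbardWave0`) are
`jwSign_inlO : σ_{inl i}(s) = σ_i(s₁)` (nothing of cluster 2 lies below cluster 1) and
`jwSign_inrO : σ_{inr j}(s) = (-1)^{#s₁} σ_j(s₂)` (ALL of cluster 1 lies below cluster 2 — the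
inter-cluster Jordan–Wigner string `(-1)^{N₁}`).

**II. Product states.** `prodState x y (s) = x (pre inlO s) · y (pre inrO s)` (the occupation-basis,
cluster-1-first tensor product; for even vectors the CAR-algebra state `P_x† P_y† |0⟩`). The
cluster-1 operators act on the first factor, `c_{inl i} (x ⊗ y) = (c_i x) ⊗ y`,
`c†_{inl i} (x ⊗ y) = (c†_i x) ⊗ y`; the cluster-2 operators act on the second factor TWISTED BY
THE PARITY OF THE FIRST, `c_{inr j} (x ⊗ y) = (P x) ⊗ (c_j y)`, `c†_{inr j} (x ⊗ y) = (P x) ⊗ (c†_j y)`,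
`P = parityOp = (-1)^N`, and `P x = (-1)^p x` on a vector of definite parity (`HasParity`). Inner
products factor (`star_prodState_dotProduct_prodState`). `IsParityPreserving` (even operators)
with its closure properties.

**III. Second quantisations.** `jwEmbed inlO a (x ⊗ y) = (a x) ⊗ y` for EVERY `a`, and
`jwEmbed inrO a (x ⊗ y) = x ⊗ (a y)` for every PARITY-PRESERVING `a` (an even operator of cluster 2
commutes through the string), so that the decoupled two-cluster Hamiltonian
`jwEmbed inlO H + jwEmbed inrO H` acts on product states as the Kronecker sum `H ⊗ 1 + 1 ⊗ H` and
product states of eigenvectors are eigenvectors with the sum of the energies.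

References: O. Bratteli, D. W. Robinson, *Operator Algebras and QSM II* (1997), §5.2.2, Thm. 5.2.5
and eq. (5.2.13) (Jordan–Wigner form of the CAR algebra of a direct sum) [BratteliRobinsonII1997];
W.-F. Tsai, S. A. Kivelson, PRB 73 (2006) 214510, App. A (signs of the pair-transfer processes)
[TsaiKivelson2006]. Tree: `annihilation_apply`, `creation_apply` (`FermionOperatorsProofs`);
`JWEmbed.pre/env/combine/envSign/transSign`, `embedFun_apply`, `sum_filter_env_eq`, `jwEmbed`
(`FermionEmbedding`). Mathlib: `Sum.Lex.inl_strictMono/inr_strictMono`, `OrderEmbedding.ofStrictMono`,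
`Sum.Lex.inl_lt_inr`, `Sum.Lex.not_inr_lt_inl`, `Equiv.sum_comp`.
-/

noncomputable section

namespace Literature.MathematicalPhysics.QuantumLattice

open Matrix Finset JWEmbed
open scoped symmDiff

namespace TwoCluster

section Order

variable {ι : Type*} [LinearOrder ι]

/-- Cluster 1 inside the two-cluster orbital set `ι ⊕ₗ ι` (an order embedding). [folklore] -/
def inlO : ι ↪o ι ⊕ₗ ι :=
  OrderEmbedding.ofStrictMono (fun i => toLex (Sum.inl i)) Sum.Lex.inl_strictMono

/-- Cluster 2 inside the two-cluster orbital set `ι ⊕ₗ ι` (an order embedding). [folklore] -/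
def inrO : ι ↪o ι ⊕ₗ ι :=
  OrderEmbedding.ofStrictMono (fun i => toLex (Sum.inr i)) Sum.Lex.inr_strictMono

/-- `inlO i` is `inl i` read in `ι ⊕ₗ ι`. [folklore] -/
@[simp] theorem inlO_apply (i : ι) : (inlO i : ι ⊕ₗ ι) = toLex (Sum.inl i) := rfl

/-- `inrO j` is `inr j` read in `ι ⊕ₗ ι`. [folklore] -/
@[simp] theorem inrO_apply (i : ι) : (inrO i : ι ⊕ₗ ι) = toLex (Sum.inr i) := rfl

/-- Orbitals of different clusters differ. [folklore] -/
@[simp] theorem inlO_ne_inrO (i j : ι) : (inlO i : ι ⊕ₗ ι) ≠ inrO j := by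
  simp [inlO, inrO]

/-- Orbitals of different clusters differ. [folklore] -/
@[simp] theorem inrO_ne_inlO (i j : ι) : (inrO j : ι ⊕ₗ ι) ≠ inlO i :=
  fun h => inlO_ne_inrO i j h.symm

/-- `inlO` is injective (as a `simp` lemma on equalities). [folklore] -/
@[simp] theorem inlO_inj {i i' : ι} : (inlO i : ι ⊕ₗ ι) = inlO i' ↔ i = i' :=
  inlO.injective.eq_iff

/-- `inrO` is injective (as a `simp` lemma on equalities). [folklore] -/
@[simp] theorem inrO_inj {j j' : ι} : (inrO j : ι ⊕ₗ ι) = inrO j' ↔ j = j' :=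
  inrO.injective.eq_iff

/-- **Every orbital of cluster 1 lies below every orbital of cluster 2.** [folklore] -/
theorem inlO_lt_inrO (i j : ι) : (inlO i : ι ⊕ₗ ι) < inrO j :=
  Sum.Lex.inl_lt_inr i j

/-- No orbital of cluster 2 lies below an orbital of cluster 1. [folklore] -/
theorem not_inrO_lt_inlO (i j : ι) : ¬ (inrO j : ι ⊕ₗ ι) < inlO i :=
  Sum.Lex.not_inr_lt_inl

/-- `inlO` reflects the order. [folklore] -/
theorem inlO_lt_inlO {i i' : ι} : (inlO i : ι ⊕ₗ ι) < inlO i' ↔ i < i' :=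
  (inlO : ι ↪o ι ⊕ₗ ι).lt_iff_lt

/-- `inrO` reflects the order. [folklore] -/
theorem inrO_lt_inrO {j j' : ι} : (inrO j : ι ⊕ₗ ι) < inrO j' ↔ j < j' :=
  (inrO : ι ↪o ι ⊕ₗ ι).lt_iff_lt

/-- Every two-cluster orbital belongs to one of the clusters. [folklore] -/
theorem eq_inlO_or_eq_inrO (x : ι ⊕ₗ ι) : (∃ i, x = inlO i) ∨ ∃ j, x = inrO j := by
  rcases hx : ofLex x with i | j
  · exact Or.inl ⟨i, by rw [inlO_apply, ← hx, toLex_ofLex]⟩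
  · exact Or.inr ⟨j, by rw [inrO_apply, ← hx, toLex_ofLex]⟩

/-! ### Splitting a two-cluster configuration -/

/-- Recombine two cluster configurations into a two-cluster configuration. [folklore] -/
def glue (a b : Finset ι) : Finset (ι ⊕ₗ ι) := a.map inlO.toEmbedding ∪ b.map inrO.toEmbedding

/-- Membership in a glued configuration. [folklore] -/
theorem mem_glue {a b : Finset ι} {x : ι ⊕ₗ ι} :
    x ∈ glue a b ↔ (∃ i ∈ a, inlO i = x) ∨ ∃ j ∈ b, inrO j = x := by
  simp [glue]

/-- A cluster-1 orbital lies in a glued configuration iff it lies in the first part. [folklore] -/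
@[simp] theorem inlO_mem_glue {a b : Finset ι} {i : ι} : (inlO i : ι ⊕ₗ ι) ∈ glue a b ↔ i ∈ a := by
  rw [mem_glue]
  constructor
  · rintro (⟨i', hi', h⟩ | ⟨j, -, h⟩)
    · rwa [← inlO_inj.1 h]
    · exact absurd h (inrO_ne_inlO i j)
  · exact fun h => Or.inl ⟨i, h, rfl⟩

/-- A cluster-2 orbital lies in a glued configuration iff it lies in the second part. [folklore] -/
@[simp] theorem inrO_mem_glue {a b : Finset ι} {j : ι} : (inrO j : ι ⊕ₗ ι) ∈ glue a b ↔ j ∈ b := by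
  rw [mem_glue]
  constructor
  · rintro (⟨i, -, h⟩ | ⟨j', hj', h⟩)
    · exact absurd h (inlO_ne_inrO i j)
    · rwa [← inrO_inj.1 h]
  · exact fun h => Or.inr ⟨j, h, rfl⟩

/-- The cluster-1 part of a glued configuration. [folklore] -/
@[simp] theorem pre_inlO_glue (a b : Finset ι) : pre inlO (glue a b) = a := by
  ext i; rw [mem_pre, inlO_mem_glue]

/-- The cluster-2 part of a glued configuration. [folklore] -/
@[simp] theorem pre_inrO_glue (a b : Finset ι) : pre inrO (glue a b) = b := by
  ext j; rw [mem_pre, inrO_mem_glue]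

/-- A two-cluster configuration is the gluing of its two parts. [folklore] -/
@[simp] theorem glue_pre (s : Finset (ι ⊕ₗ ι)) : glue (pre inlO s) (pre inrO s) = s := by
  ext x
  rcases eq_inlO_or_eq_inrO x with ⟨i, rfl⟩ | ⟨j, rfl⟩
  · rw [inlO_mem_glue, mem_pre]
  · rw [inrO_mem_glue, mem_pre]

/-- **Configurations of the two clusters ↔ pairs of configurations.** [folklore] -/
def splitEquiv : Finset (ι ⊕ₗ ι) ≃ Finset ι × Finset ι where
  toFun s := (pre inlO s, pre inrO s)
  invFun p := glue p.1 p.2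
  left_inv s := glue_pre s
  right_inv p := by simp

/-- **Sums over two-cluster configurations factor** into iterated sums over the parts.
[folklore] -/
theorem sum_split [Fintype ι] {M : Type*} [AddCommMonoid M] (F : Finset (ι ⊕ₗ ι) → M) :
    ∑ s, F s = ∑ a : Finset ι, ∑ b : Finset ι, F (glue a b) := by
  rw [← Fintype.sum_prod_type', ← (splitEquiv (ι := ι)).symm.sum_comp]
  rfl

/-! ### Inserting / erasing one orbital

(The `DecidableEq (ι ⊕ₗ ι)` instance is a free binder so that the lemmas rewrite under whichever
instance an `insert`/`erase` in the goal carries.) -/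

section InsertErase

variable [DecidableEq (ι ⊕ₗ ι)]

/-- Inserting a cluster-1 orbital inserts it into the cluster-1 part. [folklore] -/
theorem pre_inlO_insert_inlO (i : ι) (s : Finset (ι ⊕ₗ ι)) :
    pre inlO (insert (inlO i) s) = insert i (pre inlO s) := by
  ext i'; simp [mem_pre]

/-- Inserting a cluster-2 orbital inserts it into the cluster-2 part. [folklore] -/
theorem pre_inrO_insert_inrO (j : ι) (s : Finset (ι ⊕ₗ ι)) :
    pre inrO (insert (inrO j) s) = insert j (pre inrO s) := by
  ext j'; simp [mem_pre]

/-- Inserting a cluster-1 orbital leaves the cluster-2 part unchanged. [folklore] -/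
@[simp] theorem pre_inrO_insert_inlO (i : ι) (s : Finset (ι ⊕ₗ ι)) :
    pre inrO (insert (inlO i) s) = pre inrO s := by
  ext j; simp [mem_pre]

/-- Inserting a cluster-2 orbital leaves the cluster-1 part unchanged. [folklore] -/
@[simp] theorem pre_inlO_insert_inrO (j : ι) (s : Finset (ι ⊕ₗ ι)) :
    pre inlO (insert (inrO j) s) = pre inlO s := by
  ext i; simp [mem_pre]

/-- Erasing a cluster-1 orbital erases it from the cluster-1 part. [folklore] -/
theorem pre_inlO_erase_inlO (i : ι) (s : Finset (ι ⊕ₗ ι)) :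
    pre inlO (s.erase (inlO i)) = (pre inlO s).erase i := by
  ext i'; simp [mem_pre]

/-- Erasing a cluster-2 orbital erases it from the cluster-2 part. [folklore] -/
theorem pre_inrO_erase_inrO (j : ι) (s : Finset (ι ⊕ₗ ι)) :
    pre inrO (s.erase (inrO j)) = (pre inrO s).erase j := by
  ext j'; simp [mem_pre]

/-- Erasing a cluster-1 orbital leaves the cluster-2 part unchanged. [folklore] -/
@[simp] theorem pre_inrO_erase_inlO (i : ι) (s : Finset (ι ⊕ₗ ι)) :
    pre inrO (s.erase (inlO i)) = pre inrO s := by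
  ext j; simp [mem_pre]

/-- Erasing a cluster-2 orbital leaves the cluster-1 part unchanged. [folklore] -/
@[simp] theorem pre_inlO_erase_inrO (j : ι) (s : Finset (ι ⊕ₗ ι)) :
    pre inlO (s.erase (inrO j)) = pre inlO s := by
  ext i; simp [mem_pre]

end InsertErase

/-- Occupation of a cluster-1 orbital is read off the cluster-1 part. [folklore] -/
theorem inlO_mem_iff (i : ι) (s : Finset (ι ⊕ₗ ι)) : (inlO i : ι ⊕ₗ ι) ∈ s ↔ i ∈ pre inlO s :=
  mem_pre.symm

/-- Occupation of a cluster-2 orbital is read off the cluster-2 part. [folklore] -/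
theorem inrO_mem_iff (j : ι) (s : Finset (ι ⊕ₗ ι)) : (inrO j : ι ⊕ₗ ι) ∈ s ↔ j ∈ pre inrO s :=
  mem_pre.symm

/-! ### The two Jordan–Wigner signs -/

/-- The orbitals below an orbital of cluster 1 are the cluster-1 orbitals below it. [folklore] -/
theorem filter_lt_inlO (i : ι) (s : Finset (ι ⊕ₗ ι)) :
    s.filter (· < inlO i) = ((pre inlO s).filter (· < i)).map inlO.toEmbedding := by
  ext x
  simp only [Finset.mem_filter, Finset.mem_map, mem_pre, RelEmbedding.coe_toEmbedding]
  constructor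
  · rintro ⟨hx, hlt⟩
    rcases eq_inlO_or_eq_inrO x with ⟨i', rfl⟩ | ⟨j, rfl⟩
    · exact ⟨i', ⟨hx, inlO_lt_inlO.1 hlt⟩, rfl⟩
    · exact absurd hlt (not_inrO_lt_inlO i j)
  · rintro ⟨i', ⟨hi', hlt⟩, rfl⟩
    exact ⟨hi', inlO_lt_inlO.2 hlt⟩

/-- **No inter-cluster sign for cluster 1**: `σ_{inl i}(s) = σ_i(s₁)`.
[cite: BratteliRobinsonII1997, §5.2.2 eq. (5.2.13)] -/
theorem jwSign_inlO (i : ι) (s : Finset (ι ⊕ₗ ι)) : jwSign (inlO i) s = jwSign i (pre inlO s) := by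
  rw [jwSign, jwSign, filter_lt_inlO, Finset.card_map]

/-- The orbitals below an orbital of cluster 2: all of cluster 1, and the cluster-2 orbitals below
it. [folklore] -/
theorem filter_lt_inrO (j : ι) (s : Finset (ι ⊕ₗ ι)) :
    s.filter (· < inrO j) =
      (pre inlO s).map inlO.toEmbedding ∪ ((pre inrO s).filter (· < j)).map inrO.toEmbedding := by
  ext x
  simp only [Finset.mem_filter, Finset.mem_union, Finset.mem_map, mem_pre,
    RelEmbedding.coe_toEmbedding]
  constructor
  · rintro ⟨hx, hlt⟩
    rcases eq_inlO_or_eq_inrO x with ⟨i, rfl⟩ | ⟨j', rfl⟩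
    · exact Or.inl ⟨i, hx, rfl⟩
    · exact Or.inr ⟨j', ⟨hx, inrO_lt_inrO.1 hlt⟩, rfl⟩
  · rintro (⟨i, hi, rfl⟩ | ⟨j', ⟨hj', hlt⟩, rfl⟩)
    · exact ⟨hi, inlO_lt_inrO i j⟩
    · exact ⟨hj', inrO_lt_inrO.2 hlt⟩

/-- **The inter-cluster Jordan–Wigner string**: `σ_{inr j}(s) = (-1)^{#s₁} σ_j(s₂)` — an operator
of cluster 2 anticommutes past every occupied orbital of cluster 1.
[cite: BratteliRobinsonII1997, §5.2.2 eq. (5.2.13)] -/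
theorem jwSign_inrO (j : ι) (s : Finset (ι ⊕ₗ ι)) :
    jwSign (inrO j) s = (-1) ^ (pre inlO s).card * jwSign j (pre inrO s) := by
  have hdisj : Disjoint ((pre inlO s).map inlO.toEmbedding)
      (((pre inrO s).filter (· < j)).map inrO.toEmbedding) := by
    rw [Finset.disjoint_left]
    intro x hx hx'
    obtain ⟨i, -, rfl⟩ := Finset.mem_map.1 hx
    obtain ⟨j', -, h⟩ := Finset.mem_map.1 hx'
    exact inrO_ne_inlO i j' h
  rw [jwSign, jwSign, filter_lt_inrO, Finset.card_union_of_disjoint hdisj, Finset.card_map,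
    Finset.card_map, pow_add]

end Order

end TwoCluster

end Literature.MathematicalPhysics.QuantumLattice

end

noncomputable section

namespace Literature.MathematicalPhysics.QuantumLattice

open Matrix Finset JWEmbed
open scoped symmDiff

namespace TwoCluster

/-! ### Product states and the action of the cluster operators -/

section Fock

variable {ι : Type*} [LinearOrder ι]

/-- The **product state** `x ⊗ y` of two cluster vectors in the occupation basis of the two-cluster
Fock space: `(x ⊗ y)(s) = x(s₁) y(s₂)`. For vectors of even fermion parity this is the state
`P_x† P_y† |0⟩` of the CAR algebra; in general it is the Jordan–Wigner (cluster-1-first) tensor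
product. [cite: BratteliRobinsonII1997, §5.2.2] -/
def prodState (x y : Fock ι) : Fock (ι ⊕ₗ ι) := fun s => x (pre inlO s) * y (pre inrO s)

/-- Entries of a product state (definitional). [folklore] -/
@[simp] theorem prodState_apply (x y : Fock ι) (s : Finset (ι ⊕ₗ ι)) :
    prodState x y s = x (pre inlO s) * y (pre inrO s) := rfl

/-- A Fock vector has **fermion parity** `p` (mod 2) if it is supported on configurations of
cardinality `≡ p (mod 2)`. [folklore] -/
def HasParity (p : ℕ) (x : Fock ι) : Prop := ∀ s, x s ≠ 0 → s.card % 2 = p % 2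

omit [LinearOrder ι] in
/-- An `N`-particle vector has parity `N`. [folklore] -/
theorem hasParity_of_isNParticle {N : ℕ} {x : Fock ι} (hx : IsNParticle N x) : HasParity N x :=
  fun s hs => by rw [show s.card = N from by_contra fun h => hs (hx s h)]

omit [LinearOrder ι] in
/-- Parity only depends on `p mod 2`. [folklore] -/
theorem HasParity.mono {p q : ℕ} (h : p % 2 = q % 2) {x : Fock ι} (hx : HasParity p x) : HasParity q x :=
  fun s hs => (hx s hs).trans h

variable [Fintype ι]

/-- The **fermion parity operator** `P = (-1)^N` of one cluster (diagonal in the occupation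
basis). [folklore] -/
def parityOp : Matrix (Finset ι) (Finset ι) ℂ := diagonal fun s => (-1) ^ s.card

/-- `(P x)(s) = (-1)^{#s} x(s)`. [folklore] -/
theorem parityOp_mulVec_apply (x : Fock ι) (s : Finset ι) :
    (parityOp *ᵥ x) s = (-1) ^ s.card * x s := by
  rw [parityOp, mulVec_diagonal]

/-- On a vector of definite parity `p` the parity operator is the scalar `(-1)^p`. [folklore] -/
theorem parityOp_mulVec_of_hasParity {p : ℕ} {x : Fock ι} (hx : HasParity p x) :
    parityOp *ᵥ x = ((-1 : ℂ) ^ p) • x := by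
  funext s
  rw [parityOp_mulVec_apply, Pi.smul_apply, smul_eq_mul]
  by_cases hs : x s = 0
  · rw [hs, mul_zero, mul_zero]
  · rw [neg_one_pow_eq_pow_mod_two, hx s hs, ← neg_one_pow_eq_pow_mod_two]

omit [Fintype ι] in
/-- Entrywise action of an annihilation operator: `(c_i ψ)(s) = σ_i(s) ψ(s ∪ {i})` for `i ∉ s`.
[folklore] -/
theorem annihilation_mulVec_apply {κ : Type*} [LinearOrder κ] [Fintype κ] (i : κ) (ψ : Fock κ)
    (s : Finset κ) :
    (annihilation i *ᵥ ψ) s = if i ∈ s then 0 else jwSign i s * ψ (insert i s) := by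
  simp only [mulVec, dotProduct, annihilation_apply]
  by_cases hi : i ∈ s
  · simp [hi]
  · simp [hi, ite_mul, Finset.sum_ite_eq']

omit [Fintype ι] in
/-- Entrywise action of a creation operator: `(c†_i ψ)(t) = σ_i(t ∖ {i}) ψ(t ∖ {i})` for `i ∈ t`.
[folklore] -/
theorem creation_mulVec_apply {κ : Type*} [LinearOrder κ] [Fintype κ] (i : κ) (ψ : Fock κ)
    (t : Finset κ) :
    (creation i *ᵥ ψ) t = if i ∈ t then jwSign i (t.erase i) * ψ (t.erase i) else 0 := by
  simp only [mulVec, dotProduct, creation_apply]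
  by_cases hi : i ∈ t
  · have hiff : ∀ s : Finset κ, (i ∉ s ∧ t = insert i s) ↔ s = t.erase i := by
      intro s
      constructor
      · rintro ⟨his, rfl⟩
        rw [erase_insert his]
      · rintro rfl
        exact ⟨notMem_erase i t, (insert_erase hi).symm⟩
    simp only [hiff, ite_mul, zero_mul, Finset.sum_ite_eq', Finset.mem_univ, if_true, if_pos hi]
  · rw [if_neg hi]
    refine Finset.sum_eq_zero fun s _ => ?_
    rw [if_neg, zero_mul]
    rintro ⟨-, rfl⟩
    exact hi (mem_insert_self i s)

/-- **`c_{inl i} (x ⊗ y) = (c_i x) ⊗ y`.** [cite: BratteliRobinsonII1997, §5.2.2 eq. (5.2.13)] -/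
theorem annihilation_inlO_mulVec_prodState (i : ι) (x y : Fock ι) :
    annihilation (inlO i) *ᵥ prodState x y = prodState (annihilation i *ᵥ x) y := by
  funext s
  rw [annihilation_mulVec_apply, prodState_apply, prodState_apply, annihilation_mulVec_apply,
    jwSign_inlO, pre_inlO_insert_inlO, pre_inrO_insert_inlO]
  by_cases h : i ∈ pre inlO s
  · rw [if_pos ((inlO_mem_iff i s).2 h), if_pos h, zero_mul]
  · rw [if_neg (fun h' => h ((inlO_mem_iff i s).1 h')), if_neg h]
    ring

/-- **`c_{inr j} (x ⊗ y) = (P x) ⊗ (c_j y)`** — the inter-cluster Jordan–Wigner string.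
[cite: BratteliRobinsonII1997, §5.2.2 eq. (5.2.13)] -/
theorem annihilation_inrO_mulVec_prodState (j : ι) (x y : Fock ι) :
    annihilation (inrO j) *ᵥ prodState x y = prodState (parityOp *ᵥ x) (annihilation j *ᵥ y) := by
  funext s
  rw [annihilation_mulVec_apply, prodState_apply, prodState_apply, annihilation_mulVec_apply,
    parityOp_mulVec_apply, jwSign_inrO, pre_inrO_insert_inrO, pre_inlO_insert_inrO]
  by_cases h : j ∈ pre inrO s
  · rw [if_pos ((inrO_mem_iff j s).2 h), if_pos h, mul_zero]
  · rw [if_neg (fun h' => h ((inrO_mem_iff j s).1 h')), if_neg h]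
    ring

/-- **`c†_{inl i} (x ⊗ y) = (c†_i x) ⊗ y`.** [cite: BratteliRobinsonII1997, §5.2.2 eq. (5.2.13)] -/
theorem creation_inlO_mulVec_prodState (i : ι) (x y : Fock ι) :
    creation (inlO i) *ᵥ prodState x y = prodState (creation i *ᵥ x) y := by
  funext t
  rw [creation_mulVec_apply, prodState_apply, prodState_apply, creation_mulVec_apply,
    jwSign_inlO, pre_inlO_erase_inlO, pre_inrO_erase_inlO]
  by_cases h : i ∈ pre inlO t
  · rw [if_pos ((inlO_mem_iff i t).2 h), if_pos h]
    ring
  · rw [if_neg (fun h' => h ((inlO_mem_iff i t).1 h')), if_neg h, zero_mul]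

/-- **`c†_{inr j} (x ⊗ y) = (P x) ⊗ (c†_j y)`.** [cite: BratteliRobinsonII1997, §5.2.2 eq. (5.2.13)] -/
theorem creation_inrO_mulVec_prodState (j : ι) (x y : Fock ι) :
    creation (inrO j) *ᵥ prodState x y = prodState (parityOp *ᵥ x) (creation j *ᵥ y) := by
  funext t
  rw [creation_mulVec_apply, prodState_apply, prodState_apply, creation_mulVec_apply,
    parityOp_mulVec_apply, jwSign_inrO, pre_inrO_erase_inrO, pre_inlO_erase_inrO]
  by_cases h : j ∈ pre inrO t
  · rw [if_pos ((inrO_mem_iff j t).2 h), if_pos h]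
    ring
  · rw [if_neg (fun h' => h ((inrO_mem_iff j t).1 h')), if_neg h, mul_zero]

/-- Removing a fermion flips the parity. [folklore] -/
theorem HasParity.annihilation_mulVec {p : ℕ} {x : Fock ι} (hx : HasParity p x) (i : ι) :
    HasParity (p + 1) (annihilation i *ᵥ x) := by
  intro s hs
  rw [annihilation_mulVec_apply] at hs
  by_cases hi : i ∈ s
  · rw [if_pos hi] at hs
    exact absurd rfl hs
  · rw [if_neg hi] at hs
    have h := hx (insert i s) (right_ne_zero_of_mul hs)
    rw [card_insert_of_notMem hi] at h
    omega

/-- Adding a fermion flips the parity. [folklore] -/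
theorem HasParity.creation_mulVec {p : ℕ} {x : Fock ι} (hx : HasParity p x) (i : ι) :
    HasParity (p + 1) (creation i *ᵥ x) := by
  intro t ht
  rw [creation_mulVec_apply] at ht
  by_cases hi : i ∈ t
  · rw [if_pos hi] at ht
    have h := hx (t.erase i) (right_ne_zero_of_mul ht)
    have hc := card_erase_add_one hi
    omega
  · rw [if_neg hi] at ht
    exact absurd rfl ht

/-! ### Linear structure and inner products of product states -/

omit [Fintype ι] in
/-- **Bilinearity**: the product of two finite linear combinations. [folklore] -/
theorem prodState_sum_smul_sum_smul {α β : Type*} (S : Finset α) (T : Finset β)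
    (a : α → ℂ) (u : α → Fock ι) (b : β → ℂ) (w : β → Fock ι) :
    prodState (∑ μ ∈ S, a μ • u μ) (∑ ν ∈ T, b ν • w ν) =
      ∑ μ ∈ S, ∑ ν ∈ T, (a μ * b ν) • prodState (u μ) (w ν) := by
  funext s
  simp only [prodState_apply, Finset.sum_apply, Pi.smul_apply, smul_eq_mul]
  rw [Finset.sum_mul_sum]
  exact Finset.sum_congr rfl fun μ _ => Finset.sum_congr rfl fun ν _ => by ring

omit [Fintype ι] in
/-- `(c x) ⊗ y = c (x ⊗ y)`. [folklore] -/
theorem prodState_smul_left (c : ℂ) (x y : Fock ι) : prodState (c • x) y = c • prodState x y := by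
  funext s; simp [mul_assoc]

omit [Fintype ι] in
/-- `x ⊗ (c y) = c (x ⊗ y)`. [folklore] -/
theorem prodState_smul_right (c : ℂ) (x y : Fock ι) : prodState x (c • y) = c • prodState x y := by
  funext s; simp only [prodState_apply, Pi.smul_apply, smul_eq_mul]; ring

omit [Fintype ι] in
/-- `(x + x') ⊗ y = x ⊗ y + x' ⊗ y`. [folklore] -/
theorem prodState_add_left (x x' y : Fock ι) : prodState (x + x') y = prodState x y + prodState x' y := by
  funext s; simp [add_mul]

omit [Fintype ι] in
/-- `x ⊗ (y + y') = x ⊗ y + x ⊗ y'`. [folklore] -/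
theorem prodState_add_right (x y y' : Fock ι) : prodState x (y + y') = prodState x y + prodState x y' := by
  funext s; simp [mul_add]

omit [Fintype ι] in
/-- `(x - x') ⊗ y = x ⊗ y - x' ⊗ y`. [folklore] -/
theorem prodState_sub_left (x x' y : Fock ι) : prodState (x - x') y = prodState x y - prodState x' y := by
  funext s; simp [sub_mul]

omit [Fintype ι] in
/-- `x ⊗ (y - y') = x ⊗ y - x ⊗ y'`. [folklore] -/
theorem prodState_sub_right (x y y' : Fock ι) : prodState x (y - y') = prodState x y - prodState x y' := by
  funext s; simp [mul_sub]

/-- **Inner products factor**: `⟨x' ⊗ y', x ⊗ y⟩ = ⟨x', x⟩ · ⟨y', y⟩`. [folklore] -/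
theorem star_prodState_dotProduct_prodState (x' y' x y : Fock ι) :
    star (prodState x' y') ⬝ᵥ prodState x y = (star x' ⬝ᵥ x) * (star y' ⬝ᵥ y) := by
  simp only [dotProduct, Pi.star_apply, prodState_apply, star_mul']
  rw [sum_split, Finset.sum_mul_sum]
  refine Finset.sum_congr rfl fun a _ => Finset.sum_congr rfl fun b _ => ?_
  rw [pre_inlO_glue, pre_inrO_glue]
  ring


/-! ### Parity-preserving (even) operators -/

omit [Fintype ι] in
/-- An operator on a fermionic Fock space is **parity preserving** (even) if its matrix entries
between configurations of different fermion parity vanish. Particle-number conserving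
Hamiltonians and all products of an even number of creation/annihilation operators are even.
[folklore] -/
def IsParityPreserving {κ : Type*} (a : Matrix (Finset κ) (Finset κ) ℂ) : Prop :=
  ∀ s t, a s t ≠ 0 → s.card % 2 = t.card % 2

omit [Fintype ι] [LinearOrder ι] in
/-- Sums of even operators are even. [folklore] -/
theorem IsParityPreserving.add {κ : Type*} {a b : Matrix (Finset κ) (Finset κ) ℂ}
    (ha : IsParityPreserving a) (hb : IsParityPreserving b) : IsParityPreserving (a + b) := by
  intro s t h
  rw [Matrix.add_apply] at h
  by_cases has : a s t = 0
  · rw [has, zero_add] at h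
    exact hb s t h
  · exact ha s t has

omit [Fintype ι] [LinearOrder ι] in
/-- Scalar multiples of even operators are even. [folklore] -/
theorem IsParityPreserving.smul {κ : Type*} {a : Matrix (Finset κ) (Finset κ) ℂ}
    (ha : IsParityPreserving a) (c : ℂ) : IsParityPreserving (c • a) := by
  intro s t h
  rw [Matrix.smul_apply, smul_eq_mul] at h
  exact ha s t (right_ne_zero_of_mul h)

omit [Fintype ι] [LinearOrder ι] in
/-- Negatives of even operators are even. [folklore] -/
theorem IsParityPreserving.neg {κ : Type*} {a : Matrix (Finset κ) (Finset κ) ℂ}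
    (ha : IsParityPreserving a) : IsParityPreserving (-a) := by
  intro s t h
  rw [Matrix.neg_apply, neg_ne_zero] at h
  exact ha s t h

omit [Fintype ι] [LinearOrder ι] in
/-- The zero operator is even. [folklore] -/
theorem IsParityPreserving.zero {κ : Type*} : IsParityPreserving (0 : Matrix (Finset κ) (Finset κ) ℂ) :=
  fun _ _ h => absurd rfl h

omit [Fintype ι] [LinearOrder ι] in
/-- A conditional even-or-zero operator is even. [folklore] -/
theorem IsParityPreserving.ite {κ : Type*} (P : Prop) [Decidable P] {a : Matrix (Finset κ) (Finset κ) ℂ}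
    (ha : IsParityPreserving a) : IsParityPreserving (if P then a else 0) := by
  split_ifs
  exacts [ha, IsParityPreserving.zero]

omit [Fintype ι] [LinearOrder ι] in
/-- Finite sums of even operators are even. [folklore] -/
theorem IsParityPreserving.sum {κ α : Type*} {S : Finset α} {a : α → Matrix (Finset κ) (Finset κ) ℂ}
    (ha : ∀ μ ∈ S, IsParityPreserving (a μ)) : IsParityPreserving (∑ μ ∈ S, a μ) := by
  classical
  induction S using Finset.induction_on with
  | empty => rw [Finset.sum_empty]; exact IsParityPreserving.zero
  | insert μ S hμ ih =>
    rw [Finset.sum_insert hμ]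
    exact (ha μ (Finset.mem_insert_self μ S)).add (ih fun ν hν => ha ν (Finset.mem_insert_of_mem hν))

omit [Fintype ι] [LinearOrder ι] in
/-- Products of even operators are even. [folklore] -/
theorem IsParityPreserving.mul {κ : Type*} [Fintype κ] {a b : Matrix (Finset κ) (Finset κ) ℂ}
    (ha : IsParityPreserving a) (hb : IsParityPreserving b) : IsParityPreserving (a * b) := by
  intro s t h
  rw [Matrix.mul_apply] at h
  obtain ⟨u, -, hu⟩ := Finset.exists_ne_zero_of_sum_ne_zero h
  rw [ha s u (left_ne_zero_of_mul hu), hb u t (right_ne_zero_of_mul hu)]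

omit [Fintype ι] [LinearOrder ι] in
/-- Diagonal operators are even. [folklore] -/
theorem IsParityPreserving.diagonal {κ : Type*} [DecidableEq κ] (d : Finset κ → ℂ) :
    IsParityPreserving (diagonal d) := by
  intro s t h
  by_cases hst : s = t
  · rw [hst]
  · exact absurd (diagonal_apply_ne d hst) h

omit [Fintype ι] [LinearOrder ι] in
/-- The identity is even. [folklore] -/
theorem IsParityPreserving.one {κ : Type*} [DecidableEq κ] :
    IsParityPreserving (1 : Matrix (Finset κ) (Finset κ) ℂ) := by
  rw [← diagonal_one]
  exact IsParityPreserving.diagonal _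

omit [Fintype ι] in
/-- A hopping / number term `c†_i c_j` is even. [folklore] -/
theorem IsParityPreserving.creation_mul_annihilation {κ : Type*} [LinearOrder κ] [Fintype κ] (i j : κ) :
    IsParityPreserving (creation i * annihilation j) := by
  intro s t h
  rw [Matrix.mul_apply] at h
  obtain ⟨u, -, hu⟩ := Finset.exists_ne_zero_of_sum_ne_zero h
  have h1 := left_ne_zero_of_mul hu
  have h2 := right_ne_zero_of_mul hu
  rw [creation_apply] at h1
  rw [annihilation_apply] at h2
  by_cases c1 : i ∉ u ∧ s = insert i u
  · by_cases c2 : j ∉ u ∧ t = insert j u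
    · rw [c1.2, c2.2, card_insert_of_notMem c1.1, card_insert_of_notMem c2.1]
    · rw [if_neg c2] at h2; exact absurd rfl h2
  · rw [if_neg c1] at h1; exact absurd rfl h1

end Fock

end TwoCluster

end Literature.MathematicalPhysics.QuantumLattice

end

noncomputable section

namespace Literature.MathematicalPhysics.QuantumLattice

open Matrix Finset JWEmbed
open scoped symmDiff

namespace TwoCluster

/-! ### The general entrywise action of an embedded operator -/

section General

variable {ι ι' : Type*} [LinearOrder ι] [LinearOrder ι'] [Fintype ι] [Fintype ι'] (e : ι ↪o ι')

/-- **Entrywise action of a second-quantised operator**: at a configuration `u` of the big volume,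
`(jwEmbed e a Ψ)(u) = Σ_w a(pre u, w) · transSign(env u)(pre u Δ w) · Ψ(w ⊔ env u)` — only
configurations with the same environment as `u` are reached, and they are parametrised by their
image part `w`. [cite: BratteliRobinsonII1997, §5.2.2 Thm. 5.2.5] -/
theorem jwEmbed_mulVec_apply (a : Matrix (Finset ι) (Finset ι) ℂ) (Ψ : Fock ι') (u : Finset ι') :
    (jwEmbed e a *ᵥ Ψ) u =
      ∑ w : Finset ι, a (pre e u) w * transSign e (env e u) (pre e u ∆ w) * Ψ (combine e w (env e u)) := by
  rw [jwEmbed_apply, mulVec, dotProduct]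
  simp only [embedFun_apply, ite_mul, zero_mul]
  rw [Finset.sum_ite, Finset.sum_const_zero, add_zero]
  have hswap : (Finset.univ : Finset (Finset ι')).filter (fun v => env e u = env e v) =
      (Finset.univ : Finset (Finset ι')).filter (fun v => env e v = env e u) :=
    Finset.filter_congr fun v _ => eq_comm
  rw [hswap, sum_filter_env_eq (disjoint_env_rangeF u)]
  exact Finset.sum_congr rfl fun w _ => by rw [pre_combine (disjoint_env_rangeF u)]

end General

/-! ### The environment signs of the two clusters -/

section Signs

variable {ι : Type*} [LinearOrder ι] [Fintype ι]

/-- No environment orbital (an orbital of cluster 2) lies below an orbital of cluster 1.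
[folklore] -/
theorem envSign_inlO_env (u : Finset (ι ⊕ₗ ι)) (i : ι) : envSign inlO (env inlO u) i = 1 := by
  unfold envSign
  have h : (env inlO u).filter (· < inlO i) = ∅ := by
    rw [Finset.filter_eq_empty_iff]
    intro y hy hlt
    rcases eq_inlO_or_eq_inrO y with ⟨i', rfl⟩ | ⟨j, rfl⟩
    · exact (mem_env.1 hy).2 (apply_mem_rangeF i')
    · exact not_inrO_lt_inlO i j hlt
  rw [h, Finset.card_empty, pow_zero]

/-- Hence cluster-1 operators carry no environment sign. [folklore] -/
theorem transSign_inlO_env (u : Finset (ι ⊕ₗ ι)) (X : Finset ι) :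
    transSign inlO (env inlO u) X = 1 :=
  Finset.prod_eq_one fun i _ => envSign_inlO_env u i

/-- Every environment orbital (an orbital of cluster 1) lies below an orbital of cluster 2: the
environment sign of cluster 2 is the parity `(-1)^{N₁}`. [folklore] -/
theorem envSign_inrO_env (u : Finset (ι ⊕ₗ ι)) (j : ι) :
    envSign inrO (env inrO u) j = (-1) ^ (env inrO u).card := by
  unfold envSign
  have h : (env inrO u).filter (· < inrO j) = env inrO u := by
    refine Finset.filter_true_of_mem fun y hy => ?_
    rcases eq_inlO_or_eq_inrO y with ⟨i, rfl⟩ | ⟨j', rfl⟩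
    · exact inlO_lt_inrO i j
    · exact absurd (apply_mem_rangeF j') (mem_env.1 hy).2
  rw [h]

/-- Hence a product of `#X` cluster-2 operators carries the sign `(-1)^{N₁ · #X}`. [folklore] -/
theorem transSign_inrO_env (u : Finset (ι ⊕ₗ ι)) (X : Finset ι) :
    transSign inrO (env inrO u) X = (-1) ^ ((env inrO u).card * X.card) := by
  unfold transSign
  simp only [envSign_inrO_env]
  rw [Finset.prod_const, ← pow_mul]

/-- Gluing an image part of cluster 1 onto the environment of `u` does not change the cluster-2
part. [folklore] -/
theorem pre_inrO_combine_inlO (w : Finset ι) (u : Finset (ι ⊕ₗ ι)) :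
    pre inrO (combine inlO w (env inlO u)) = pre inrO u := by
  ext j
  rw [mem_pre, mem_combine, mem_pre]
  constructor
  · rintro (⟨i, -, h⟩ | h)
    · exact absurd h (inlO_ne_inrO i j)
    · exact (mem_env.1 h).1
  · intro h
    refine Or.inr (mem_env.2 ⟨h, fun hr => ?_⟩)
    obtain ⟨i, hi⟩ := mem_rangeF.1 hr
    exact inlO_ne_inrO i j hi

/-- Gluing an image part of cluster 2 onto the environment of `u` does not change the cluster-1
part. [folklore] -/
theorem pre_inlO_combine_inrO (w : Finset ι) (u : Finset (ι ⊕ₗ ι)) :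
    pre inlO (combine inrO w (env inrO u)) = pre inlO u := by
  ext i
  rw [mem_pre, mem_combine, mem_pre]
  constructor
  · rintro (⟨j, -, h⟩ | h)
    · exact absurd h (inrO_ne_inlO i j)
    · exact (mem_env.1 h).1
  · intro h
    refine Or.inr (mem_env.2 ⟨h, fun hr => ?_⟩)
    obtain ⟨j, hj⟩ := mem_rangeF.1 hr
    exact inrO_ne_inlO i j hj

omit [Fintype ι] in
/-- Configurations of equal parity have a symmetric difference of even size. [folklore] -/
theorem even_card_symmDiff_of_card_mod_two_eq {s t : Finset ι} (h : s.card % 2 = t.card % 2) :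
    Even (s ∆ t).card := by
  have h1 := Finset.card_sdiff_add_card_inter s t
  have h2 := Finset.card_sdiff_add_card_inter t s
  have h3 : (s ∆ t).card = (s \ t).card + (t \ s).card := by
    rw [symmDiff_def, Finset.sup_eq_union, Finset.card_union_of_disjoint disjoint_sdiff_sdiff]
  rw [Finset.inter_comm] at h2
  rw [Nat.even_iff]
  omega

end Signs

/-! ### Embedded operators on product states -/

section ProdState

variable {ι : Type*} [LinearOrder ι] [Fintype ι]

/-- **A cluster-1 operator acts on the first factor**: `(jwEmbed inlO a)(x ⊗ y) = (a x) ⊗ y` for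
every operator `a` of cluster 1 (no Jordan–Wigner string: cluster 1 is lowest).
[cite: BratteliRobinsonII1997, §5.2.2 Thm. 5.2.5] -/
theorem jwEmbed_inlO_mulVec_prodState (a : Matrix (Finset ι) (Finset ι) ℂ) (x y : Fock ι) :
    jwEmbed inlO a *ᵥ prodState x y = prodState (a *ᵥ x) y := by
  funext u
  rw [jwEmbed_mulVec_apply, prodState_apply, mulVec, dotProduct, Finset.sum_mul]
  refine Finset.sum_congr rfl fun w _ => ?_
  rw [transSign_inlO_env, mul_one, prodState_apply, pre_combine (disjoint_env_rangeF u),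
    pre_inrO_combine_inlO]
  ring

/-- **An even cluster-2 operator acts on the second factor**: `(jwEmbed inrO a)(x ⊗ y) = x ⊗ (a y)`
for every parity-preserving operator `a` of cluster 2 — its Jordan–Wigner string through cluster 1,
`(-1)^{N₁ · #(s₂ Δ t₂)}`, is `+1` because `a` only connects configurations of equal parity.
[cite: BratteliRobinsonII1997, §5.2.2 Thm. 5.2.5] -/
theorem jwEmbed_inrO_mulVec_prodState {a : Matrix (Finset ι) (Finset ι) ℂ} (ha : IsParityPreserving a)
    (x y : Fock ι) :
    jwEmbed inrO a *ᵥ prodState x y = prodState x (a *ᵥ y) := by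
  funext u
  rw [jwEmbed_mulVec_apply, prodState_apply, mulVec, dotProduct, Finset.mul_sum]
  refine Finset.sum_congr rfl fun w _ => ?_
  rw [transSign_inrO_env, prodState_apply, pre_combine (disjoint_env_rangeF u),
    pre_inlO_combine_inrO]
  by_cases h : a (pre inrO u) w = 0
  · rw [h]; ring
  · have hev : Even ((env inrO u).card * (pre inrO u ∆ w).card) :=
      (even_card_symmDiff_of_card_mod_two_eq (ha _ _ h)).mul_left _
    rw [hev.neg_one_pow]
    ring

/-- **The decoupled two-cluster Hamiltonian on product states is the Kronecker sum**:
`(jwEmbed inlO H + jwEmbed inrO H)(x ⊗ y) = (H x) ⊗ y + x ⊗ (H y)` for a parity-preserving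
(e.g. particle-number conserving) cluster Hamiltonian `H`. Kato 1966, II-§2.2 (`H₀` of two
decoupled systems); Tsai–Kivelson 2006, App. A. [cite: TsaiKivelson2006, App. A] -/
theorem twoClusterHamiltonian_mulVec_prodState {H : Matrix (Finset ι) (Finset ι) ℂ}
    (hH : IsParityPreserving H) (x y : Fock ι) :
    (jwEmbed inlO H + jwEmbed inrO H) *ᵥ prodState x y =
      prodState (H *ᵥ x) y + prodState x (H *ᵥ y) := by
  rw [add_mulVec, jwEmbed_inlO_mulVec_prodState, jwEmbed_inrO_mulVec_prodState hH]

/-- Product states of eigenvectors are eigenvectors of the decoupled two-cluster Hamiltonian, with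
the SUM of the energies. [cite: TsaiKivelson2006, App. A] -/
theorem twoClusterHamiltonian_mulVec_prodState_of_eigenvector {H : Matrix (Finset ι) (Finset ι) ℂ}
    (hH : IsParityPreserving H) {x y : Fock ι} {lam mu : ℂ} (hx : H *ᵥ x = lam • x)
    (hy : H *ᵥ y = mu • y) :
    (jwEmbed inlO H + jwEmbed inrO H) *ᵥ prodState x y = (lam + mu) • prodState x y := by
  rw [twoClusterHamiltonian_mulVec_prodState hH, hx, hy, prodState_smul_left, prodState_smul_right,
    add_smul]

/-- The decoupled two-cluster Hamiltonian is Hermitian if the cluster Hamiltonian is. [folklore] -/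
theorem isHermitian_twoClusterHamiltonian {H : Matrix (Finset ι) (Finset ι) ℂ} (hH : H.IsHermitian) :
    (jwEmbed inlO H + jwEmbed inrO H).IsHermitian := by
  refine IsHermitian.add ?_ ?_
  · unfold IsHermitian
    rw [← jwEmbed_conjTranspose, hH.eq]
  · unfold IsHermitian
    rw [← jwEmbed_conjTranspose, hH.eq]

end ProdState

end TwoCluster

end Literature.MathematicalPhysics.QuantumLattice

end
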